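import Summits.QuantumFields.YangMills.Theorems.BalabanUVNodesK0AxTransverseWardRoadTrace
import Summits.QuantumFields.YangMills.Theorems.BalabanUVNodesK0AxGaugeFlowRec

/-!
# K0ᴬ TRANSVERSE WARD READ-OUT — PART 3C: THE TRACE-FORM TRANSVERSE ROAD AT THE RECORD'S CHART DATA (`hEq`, `hN`, `hfl`, `ChartSymm` DISCHARGED BY NAME)

PART C of ◇ lens-1 g7's `nodeO-cover/LENS-1-RoadTraceAtRecord-v1.lean` (◆ CRIT-1 g35 CUT №3 PASS ×3), landed by porter `ymgap-nodeO-port-PTB-1` g4 after PART A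
(✓ `…K0AxTransverseWardRoadTrace`) and leaf (B) (✓ `…K0AxGaugeFlowRec`): ★ `chartSymm_recordAdJ` (every constant `h ∈ SU(2)` is a chart symmetry of the record's two-block chart,
▶ PTA-2's ✓`chartEquivariantAtJ` through the Literature row `B12ChartGaugeFlow48.ChartSymm`) and ★★★ `decay510_plimOf_of_rows_trace_transverse_record` — PART A's
`Road.decay510_plimOf_of_rows_trace_transverseSymm` with `S, M, m, Gg, P, act, coords, χ, toG, A, gradLeg` := the record's names along ANY member map `K : ℕ → ℕ`, and the structural
binders `hEq` (✓`chartEquivariantAtJ`), `hN` (✓`noInvariantCovectorAtJ`), `hfl` (✓`chartGaugeFlow_record`) and the `ChartSymm` conjunct (✓`chartSymm_recordAdJ`) DISCHARGED BY NAME.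
What remains displayed: FORMAT⁺ᴳ, `Chart44D`, the (A3) cut, per-colour gauge decay of the cut tabulated legs, the three leaves, the window isometry, (1.21), and RowLᵀ♯ at the record
(= receipt (C)♯, OPEN · M modulo P0).  `--supports stmt-QuantumFields-27238 --as helper`.  [I] = [Balaban1987RG1], [15] = [Balaban1985Variational], [B6] = [Balaban1984PropagatorsII].

HONEST FRAMING.  Generic implications over DISPLAYED rows + finite-dimensional matrix calculus at the record; NOTHING of Bałaban ([I] Thm 1, (1.19)–(1.22), (4.8), (4.14)–(4.15),
(4.35)–(4.37), (5.10); [15] Thm 1, Prop. 9, (190); [B6] (2.35), Prop. 2.5 AT THE RECORD) is asserted, ported or discharged; (C)♯ OPEN · M modulo P0; K0ᴬ 27238 OPEN; NODE O 0∕1;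
COUNT 8∕28 · K 1∕4 UNMOVED; ONE finite `𝕋⁴_{L^K}` at fixed ε — NOT continuum ∕ OS ∕ Clay; **the Yang–Mills mass gap (Clay) is NOT proved by any of this.**
-/

noncomputable section

open scoped BigOperators Matrix.Norms.L2Operator Topology
open Set Filter Metric
open NormedSpace (exp)

/-! # PART C — THE ROAD AT THE RECORD'S CHART DATA: `hEq`, `hN`, `hfl` and the `ChartSymm` conjunct DISCHARGED BY NAME -/

namespace Summit.QuantumFields.YangMills.Theorems.K0AxGaugeFlowRec

open Summit.QuantumFields.YangMills.Theorems.K0RecordFormatNames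
open Summit.QuantumFields.YangMills.Theorems
open Literature.MathematicalPhysics.QuantumFieldTheory.Balaban1983to89
open Literature.MathematicalPhysics.QuantumFieldTheory.Balaban1983to89.Node00
open Literature.MathematicalPhysics.QuantumFieldTheory.Balaban1983to89.T4Continuum (T4Family)
open Literature.MathematicalPhysics.QuantumFieldTheory.Balaban1983to89.B12FormatPlus
open Literature.MathematicalPhysics.QuantumFieldTheory.Balaban1983to89.B12Decay510 (GeomLeaf CubeSumLeaf TreeLeaf delta1)

variable (F : T4Family)

/-! ## §9  Every constant rotation is a chart symmetry at the record (= `LENS-1-RowLTRec-v1.lean` 93f2cdb80c96fc7a §4; one name on landing) -/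

/-- ★ **`ChartSymm (recordAct) (recordChartJ) n (recordAdJ h)` for every constant `h ∈ SU(2)`** along any member map `K : ℕ → ℕ` — the first conjunct of the RowLᵀ♯ binder DISCHARGED at the
record (▶ PTA-2's ✓ `chartEquivariantAtJ` through (L)'s `chartSymm_of_chartEquivariant`; witness `recordToG h`). [cite: Balaban1987RG1, (4.8) p.283, (1.10) p.262] -/
theorem chartSymm_recordAdJ (Mc k : ℕ) (K : ℕ → ℕ) (n : ℕ) (h : SU 2) :
    B12ChartGaugeFlow48.ChartSymm (S := fun n => recordDomSys F Mc k (K n)) (M := fun n => recordBondCount F (K n)) (m := fun n => recordChartDimJ F (K n))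
      (Gg := fun n => recordGaugeGrp F (K n)) (fun n => recordAct F (K n)) (fun n => recordChartJ F Mc k (K n)) n (recordAdJ F (K n) h) :=
  B12ChartGaugeFlow48.chartSymm_of_chartEquivariant (S := fun n => recordDomSys F Mc k (K n)) (toG := fun n => recordToG F (K n))
    (A := fun n => recordAdJ F (K n)) (fun n X g u => BalabanUVNodesPortS1.chartEquivariantAtJ F Mc k (K n) X g u) n h

/-! ## §10  ★★★ THE TRACE-FORM TRANSVERSE ROAD AT THE RECORD'S CHART DATA -/

section RoadAtRecord

variable {𝔄 : Type} [NormedRing 𝔄] [NormedAlgebra ℝ 𝔄] {V : Type} [NormedAddCommGroup V] [NormedSpace ℝ V] {ι : Type} [Fintype ι] [DecidableEq ι]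
  (fam : TermFamily1 F 𝔄) (ρ : V →L[ℝ] 𝔄) (bV : Module.Basis ι ℝ V) (k : ℕ) (v : Fin (k + 1) → ℝ)

/-- ★★★ **THE (5.10) ROAD AT THE RECORD'S CHART DATA, STRUCTURAL ROWS DISCHARGED**: `Road.decay510_plimOf_of_rows_trace_transverseSymm` with the domain system, bond count, chart dimension,
gauge group, leg-parameter space, action, local coordinates, chart, root embedding, adjoint action and pure-gauge legs := the record's `recordDomSys ∕ recordBondCount ∕ recordChartDimJ ∕
recordGaugeGrp ∕ (sites → ℂ³) ∕ recordAct ∕ recordCoords ∕ recordChartJ ∕ recordToG ∕ recordAdJ ∕ recordGradLeg` along any member map `K`, and `hEq := chartEquivariantAtJ` (✓ tree),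
`hN := noInvariantCovectorAtJ` (✓ tree), `hfl := chartGaugeFlow_record` (leaf (B), PART B), and the `ChartSymm` conjunct of RowLᵀ♯ := `chartSymm_recordAdJ` — so the response row the
JOIN must supply is exactly «`∀ a, ∃ h : SU 2, ∀ μ z, ∃ φ, Dιₙ(0)(δ_{μz}·bV a) − Ad_h (Gc n a (e μ z)) = recordGradLeg φ`» (receipt (C)♯ at the JOIN's labels).  What stays displayed:
FORMAT⁺ᴳ, `Chart44D`, the (A3) cut, per-colour gauge decay of the cut tabulated legs, leaves, window isometry, (1.21).
[cite: Balaban1987RG1, (5.10) p.293, (4.35)–(4.37) pp.290–291, (4.8) p.283, (4.14)–(4.15) p.284, (1.9)–(1.10) pp.261–262, (1.18)–(1.21) pp.263–264; Balaban1985Variational, Prop. 9 p.309,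
(176) p.306, (21) p.281; Balaban1984PropagatorsII, (2.35) p.228] -/
theorem decay510_plimOf_of_rows_trace_transverse_record (Mc : ℕ) (K : ℕ → ℕ)
    (Uc : (n : ℕ) → (recordDomSys F Mc k (K n)).Dom → Set (Fin (recordBondCount F (K n)) → ℂ))
    (D : (n : ℕ) → (recordDomSys F Mc k (K n)).Dom → Set (Fin (recordChartDimJ F (K n)) → ℂ))
    (R : Response9Data (fun n => recordDomSys F Mc k (K n)) (fun n => recordBondCount F (K n)) (fun n => recordChartDimJ F (K n)) 4)
    (Gc : (n : ℕ) → ι → R.Λ n → (Fin (recordChartDimJ F (K n)) → ℂ))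
    (ιe : (n : ℕ) → (Fin (F.P (K n)).d → Site (F.P (K n)) (k + 1) → V) → (Fin (recordChartDimJ F (K n)) → ℂ))
    {E₀ κ C₉ δ₀ Mg c₁ K₀ K₁ : ℝ} (hE₀ : 0 ≤ E₀) (hκ : 0 ≤ κ) (hC₉ : 0 ≤ C₉) (hδ₀ : 0 ≤ δ₀) (hMg : 0 < Mg) (hK₀ : 0 ≤ K₀)
    (hA : FormatPlusG (fun n => recordDomSys F Mc k (K n)) (fun n => recordBondCount F (K n)) (fun n => recordAct F (K n)) Uc
      (fun n => recordCoords F Mc k (K n)) (fun n => recordChartDimJ F (K n)) (fun n => recordChartJ F Mc k (K n)) (fun n => ΦfOf F fam ρ k v (K n)) ιe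
      R.wrap R.emb R.πc E₀ κ)
    (hC : Chart44D (fun n => recordDomSys F Mc k (K n)) (fun n => recordBondCount F (K n)) Uc (fun n => recordChartDimJ F (K n))
      (fun n => recordChartJ F Mc k (K n)) D)
    (hcut : ∀ n X u, ∀ i ∈ recordCoords F Mc k (K n) X, recordChartJ F Mc k (K n) X (cutTo (R.cX n X) u) i = recordChartJ F Mc k (K n) X u i)
    (hdec : ∀ n (a : ι) X y, gauge (D n X) (cutTo (R.cX n X) (Gc n a y)) ≤ C₉ * Real.exp (-δ₀ * (R.G n).distD y X))
    (hgeo : ∀ n, GeomLeaf (R.G n) (R.ρ n) Mg c₁) (hcube : ∀ n, CubeSumLeaf (R.G n) (δ₀ / 2) K₁) (htree : ∀ n, TreeLeaf (R.Cc n) (κ / 2) K₀)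
    (hρ : ∀ (μ ν : Fin 4) (z : Fin 4 → ℤ), ∀ᶠ n in atTop, R.ρ n (R.e n μ 0) (R.e n ν z) = B12Sec2to5.l1 z)
    (hL : ∀ n, ιe n 0 = 0 ∧ ContDiffAt ℝ 2 (ιe n) 0 ∧ ∀ a : ι, ∃ h : SU 2, ∀ (μ : Fin 4) (z : Fin 4 → ℤ), ∃ φ : Site (F.P (K n)) 0 → Fin 3 → ℂ,
      fderiv ℝ (ιe n) 0 (Pi.single (Fin.cast (F.P_d (K n)).symm μ) (Pi.single (siteOfInt F (K n) (k + 1) z) (bV a))) -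
        recordAdJ F (K n) h (Gc n a (R.e n μ z)) = recordGradLeg F (K n) φ)
    (hLim : Limit121 (fun n => pvolOf F fam ρ bV k v (K n)) (plimOf F fam ρ bV k v)) :
    B12Sec2to5.Decay510 (plimOf F fam ρ bV k v 0 1) (16 * E₀ * C₉ ^ 2 * Real.exp (delta1 δ₀ κ Mg * Mg * c₁) * K₀ * K₁) (delta1 δ₀ κ Mg) :=
  K0AxTransverseWard.Road.decay510_plimOf_of_rows_trace_transverseSymm F fam ρ bV k v Uc (fun n => recordCoords F Mc k (K n))
    (fun n => recordChartJ F Mc k (K n)) D (fun n => recordAct F (K n)) (fun n => recordToG F (K n)) (fun n => recordAdJ F (K n))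
    (fun n => recordGradLeg F (K n)) R K Gc ιe hE₀ hκ hC₉ hδ₀ hMg hK₀ hA hC
    (fun n X g u => BalabanUVNodesPortS1.chartEquivariantAtJ F Mc k (K n) X g u) (fun n => BalabanUVNodesPortS1.noInvariantCovectorAtJ F (K n))
    (chartGaugeFlow_record F Mc k K) hcut hdec hgeo hcube htree hρ
    (fun n => ⟨(hL n).1, (hL n).2.1, fun a => by
      obtain ⟨h, hh⟩ := (hL n).2.2 a
      exact ⟨recordAdJ F (K n) h, chartSymm_recordAdJ F Mc k K n h, hh⟩⟩) hLim

end RoadAtRecord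

end Summit.QuantumFields.YangMills.Theorems.K0AxGaugeFlowRec

end
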